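import Summits.Ventures.DiscreteObjects.PP12.OrderThirteenColumnGram

/-!
# PP(12), order-13 cell: the TRANSPOSE of valid lift data is valid (duality in the kernel)
Framing: lottery ticket; floor = certified bounds/negative ranges.

Cell pub-namedobj (venture DiscreteObjects), target (M), designs gen 19. For lift data `D : LiftData N p` (`OrderThirteenCollineation`) let `D.transpose` exchange the
roles of line orbits and point orbits (`mem s t x ↦ mem t s x`). If `D` is valid (every two lines meet exactly once) then so is `D.transpose` (every two points
are joined exactly once): the column partition, the column internal differences and the column cross differences are exact. Uniqueness in each of the three
column conditions is a one-line consequence of the row conditions (a repeated column difference is a repeated row difference read the other way); existence is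
the counting of `OrderThirteenOrbitMatrix` / `OrderThirteenColumnGram` (column sums `p − 1`, column Gram `Σ_s m² = 2(p−1)`, `Σ_s m m' = p − 1`) combined with
injectivity (pigeonhole on the `p − 1` non-zero residues). Consequences for a kernel certificate of `NoLiftData13`: (i) the dual pruning rules of a lift search
are sound; (ii) an orbit-matrix class and its transpose class need only ONE refutation (`noLiftData13` may quotient by transposition: 38 → 26 classes of designs g3).
No `sorry`, no new axioms; nothing here asserts any census statement.
-/

namespace Summit.Ventures.DiscreteObjects.PP12

namespace LiftData

open Finset

variable {N p : ℕ}

/-- the transposed lift data: point orbits become line orbits and conversely -/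
def transpose (D : LiftData N p) : LiftData N p := ⟨fun s t x => D.mem t s x⟩

/-- membership in the transpose -/
@[simp] theorem transpose_mem (D : LiftData N p) (s t : Fin N) (x : Fin p) : D.transpose.mem s t x = D.mem t s x := rfl

/-- transposing twice is the identity -/
theorem transpose_transpose (D : LiftData N p) : D.transpose.transpose = D := by
  cases D; rfl

/-- the orbit matrix of the transpose is the transposed orbit matrix -/
theorem om_transpose (D : LiftData N p) (s t : Fin N) : D.transpose.om s t = D.om t s := rfl

variable [NeZero p]

/-- uniqueness half of the column partition: two cells of one column are disjoint ((U·U′), first clause) -/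
theorem col_mem_unique (D : LiftData N p) (hV : D.Valid) {t : Fin N} {x : Fin p} {s s' : Fin N}
    (h : D.mem s t x = true) (h' : D.mem s' t x = true) : s' = s := by
  by_contra hne
  exact (hV.2 s' s hne).1 t x ⟨h', h⟩

/-- **column partition**: the cells of a column partition the non-zero residues -/
theorem rowPartition_transpose (D : LiftData N p) (hV : D.Valid) (t : Fin N) : D.transpose.RowPartition t := by
  refine ⟨fun s => (hV.1 s).1.1 t, fun x hx => ?_⟩
  -- existence by counting: the disjoint cells of column `t` have `p − 1` elements in total, all non-zero
  have hcover : x ∈ univ.biUnion fun s => D.cell s t := by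
    have hsub : (univ.biUnion fun s => D.cell s t) ⊆ univ.filter fun y : Fin p => y ≠ 0 := by
      intro y hy
      simp only [mem_biUnion, mem_univ, true_and, mem_cell] at hy
      obtain ⟨s, hs⟩ := hy
      simp only [mem_filter, mem_univ, true_and]
      rintro rfl
      rw [(hV.1 s).1.1 t] at hs
      exact Bool.false_ne_true hs
    have hcard : (univ.biUnion fun s => D.cell s t).card = (univ.filter fun y : Fin p => y ≠ 0).card := by
      rw [card_nonzero, card_biUnion]
      · exact D.om_col_sum hV t
      · intro s _ s' _ hss
        show Disjoint (D.cell s t) (D.cell s' t)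
        rw [Finset.disjoint_left]
        intro y hy hy'
        rw [mem_cell] at hy hy'
        exact (hV.2 s s' hss).1 t y ⟨hy, hy'⟩
    rw [Finset.eq_of_subset_of_card_le hsub hcard.ge]
    simp [hx]
  simp only [mem_biUnion, mem_univ, true_and, mem_cell] at hcover
  obtain ⟨s, hs⟩ := hcover
  exact ⟨s, hs, fun s' hs' => D.col_mem_unique hV hs hs'⟩

/-- uniqueness of column internal differences: a non-zero residue is realised at most once as a difference inside the cells of one column -/
theorem col_internal_unique (D : LiftData N p) (hV : D.Valid) {t : Fin N} {δ : Fin p} (hδ : δ ≠ 0) {s s' : Fin N} {x x' : Fin p}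
    (h1 : D.mem s t x = true) (h2 : D.mem s t (x - δ) = true) (h1' : D.mem s' t x' = true) (h2' : D.mem s' t (x' - δ) = true) :
    s' = s ∧ x' = x := by
  by_cases hss : s' = s
  · subst hss
    obtain ⟨t₀, x₀, -, -, huniq⟩ := (hV.1 s').2 δ hδ
    have e := huniq t x h1 h2
    have e' := huniq t x' h1' h2'
    exact ⟨rfl, e'.2.trans e.2.symm⟩
  · -- the cross difference `x' − x` of rows `s', s` would be realised twice in column `t`
    exfalso
    have hd : x' - x ≠ 0 := by
      intro e
      have exx : x' = x := sub_eq_zero.1 e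
      exact (hV.2 s' s hss).1 t x ⟨exx ▸ h1', h1⟩
    obtain ⟨t₀, x₀, -, -, huniq⟩ := (hV.2 s' s hss).2 (x' - x) hd
    have e := huniq t x' h1' (by rw [sub_sub_cancel]; exact h1)
    have e' := huniq t (x' - δ) h2' (by rw [sub_sub_sub_cancel_left]; exact h2)
    have : x' - δ = x' := e'.2.trans e.2.symm
    exact hδ (by simpa using this)

/-- **column internal differences**: every non-zero residue exactly once inside the cells of a column (needs `2 ≤ p` for the column Gram) -/
theorem internal_transpose (D : LiftData N p) (hV : D.Valid) (hp : 2 ≤ p) (t : Fin N) : D.transpose.Internal t := by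
  intro δ hδ
  -- the difference map on the internal pairs of column `t` is injective into the `p − 1` non-zero residues and the pairs are `p − 1` in number
  have hinj : Set.InjOn (fun q : Fin N × Fin p × Fin p => q.2.1 - q.2.2) (D.transpose.intPairs t) := by
    intro q hq q' hq' e
    simp only [intPairs, coe_filter, mem_univ, true_and, Set.mem_setOf_eq, transpose_mem] at hq hq'
    have hd : q.2.1 - q.2.2 ≠ 0 := fun e0 => hq.1 (sub_eq_zero.1 e0)
    have k := D.col_internal_unique hV hd hq.2.1 (by rw [sub_sub_cancel]; exact hq.2.2) hq'.2.1
      (by rw [show q.2.1 - q.2.2 = q'.2.1 - q'.2.2 from e, sub_sub_cancel]; exact hq'.2.2)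
    have hy : q'.2.2 = q.2.2 := by
      have := congrArg (fun d => q'.2.1 - d) e
      simp only [sub_sub_cancel] at this
      rw [← this, k.2, sub_sub_cancel]
    exact Prod.ext k.1.symm (Prod.ext k.2.symm hy.symm)
  have himg : (D.transpose.intPairs t).image (fun q => q.2.1 - q.2.2) = univ.filter fun y : Fin p => y ≠ 0 := by
    apply Finset.eq_of_subset_of_card_le
    · intro d hd
      simp only [mem_image] at hd
      obtain ⟨q, hq, rfl⟩ := hd
      simp only [intPairs, mem_filter, mem_univ, true_and] at hq
      simp only [mem_filter, mem_univ, true_and]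
      exact fun e => hq.1 (sub_eq_zero.1 e)
    · rw [card_image_of_injOn hinj, card_nonzero, card_intPairs_eq_sum]
      have h1 := (D.om_col_equations hV hp).1 t
      have h2 := D.om_col_sum hV t
      simp only [om_transpose]
      -- Σ m(m−1) = Σ m² − Σ m = 2(p−1) − (p−1)
      have e : ∑ s, D.om s t * (D.om s t - 1) + ∑ s, D.om s t = ∑ s, D.om s t * D.om s t := by
        rw [← Finset.sum_add_distrib]
        exact Finset.sum_congr rfl fun s _ => mul_pred_add_self _
      omega
  have hmem : δ ∈ (D.transpose.intPairs t).image (fun q => q.2.1 - q.2.2) := by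
    rw [himg]; simp [hδ]
  simp only [mem_image] at hmem
  obtain ⟨q, hq, hqδ⟩ := hmem
  simp only [intPairs, mem_filter, mem_univ, true_and, transpose_mem] at hq
  refine ⟨q.1, q.2.1, hq.2.1, by rw [← hqδ, sub_sub_cancel]; exact hq.2.2, fun s' x' h1' h2' => ?_⟩
  simp only [transpose_mem] at h1' h2'
  exact D.col_internal_unique hV hδ hq.2.1 (by rw [← hqδ, sub_sub_cancel]; exact hq.2.2) h1' h2'

/-- uniqueness of column cross differences: for columns `t ≠ t'` a non-zero residue is realised at most once as `x − y`, `x ∈ E_{s,t}`, `y ∈ E_{s,t'}` -/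
theorem col_cross_unique (D : LiftData N p) (hV : D.Valid) {t t' : Fin N} (htt : t ≠ t') {δ : Fin p} {s s' : Fin N} {x x' : Fin p}
    (h1 : D.mem s t x = true) (h2 : D.mem s t' (x - δ) = true) (h1' : D.mem s' t x' = true) (h2' : D.mem s' t' (x' - δ) = true) :
    s' = s ∧ x' = x := by
  by_cases hss : s' = s
  · subst hss
    -- the internal difference `x' − x` of row `s'` would sit in cell `t` and in cell `t'`
    by_cases hxx : x' = x
    · exact ⟨rfl, hxx⟩
    exfalso
    have hd : x' - x ≠ 0 := fun e => hxx (sub_eq_zero.1 e)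
    obtain ⟨t₀, x₀, -, -, huniq⟩ := (hV.1 s').2 (x' - x) hd
    have e := huniq t x' h1' (by rw [sub_sub_cancel]; exact h1)
    have e' := huniq t' (x' - δ) h2' (by rw [sub_sub_sub_cancel_left]; exact h2)
    exact htt (e.1.trans e'.1.symm)
  · exfalso
    have hd : x' - x ≠ 0 := by
      intro e
      have exx : x' = x := sub_eq_zero.1 e
      exact (hV.2 s' s hss).1 t x ⟨exx ▸ h1', h1⟩
    obtain ⟨t₀, x₀, -, -, huniq⟩ := (hV.2 s' s hss).2 (x' - x) hd
    have e := huniq t x' h1' (by rw [sub_sub_cancel]; exact h1)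
    have e' := huniq t' (x' - δ) h2' (by rw [sub_sub_sub_cancel_left]; exact h2)
    exact htt (e.1.trans e'.1.symm)

/-- **column cross differences**: for columns `t ≠ t'`, the cells are row-wise disjoint and every non-zero residue is realised exactly once -/
theorem cross_transpose (D : LiftData N p) (hV : D.Valid) (hp : 2 ≤ p) {t t' : Fin N} (htt : t ≠ t') : D.transpose.Cross t t' := by
  refine ⟨fun s x hx => ?_, fun δ hδ => ?_⟩
  · simp only [transpose_mem] at hx
    have hx0 : x ≠ 0 := by
      rintro rfl; rw [(hV.1 s).1.1 t] at hx; exact Bool.false_ne_true hx.1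
    obtain ⟨u, -, huniq⟩ := (hV.1 s).1.2 x hx0
    exact htt ((huniq t hx.1).trans (huniq t' hx.2).symm)
  · have hinj : Set.InjOn (fun q : Fin N × Fin p × Fin p => q.2.1 - q.2.2) (D.transpose.crossPairs t t') := by
      intro q hq q' hq' e
      simp only [crossPairs, coe_filter, mem_univ, true_and, Set.mem_setOf_eq, transpose_mem] at hq hq'
      have k := D.col_cross_unique hV htt hq.1 (by rw [sub_sub_cancel]; exact hq.2) hq'.1
        (by rw [show q.2.1 - q.2.2 = q'.2.1 - q'.2.2 from e, sub_sub_cancel]; exact hq'.2)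
      have hy : q'.2.2 = q.2.2 := by
        have := congrArg (fun d => q'.2.1 - d) e
        simp only [sub_sub_cancel] at this
        rw [← this, k.2, sub_sub_cancel]
      exact Prod.ext k.1.symm (Prod.ext k.2.symm hy.symm)
    have hne0 : ∀ q ∈ D.transpose.crossPairs t t', q.2.1 - q.2.2 ≠ 0 := by
      intro q hq e
      simp only [crossPairs, mem_filter, mem_univ, true_and, transpose_mem] at hq
      have exy : q.2.1 = q.2.2 := sub_eq_zero.1 e
      have hx0 : q.2.1 ≠ 0 := by
        rintro h0; rw [h0, (hV.1 q.1).1.1 t] at hq; exact Bool.false_ne_true hq.1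
      obtain ⟨u, -, huniq⟩ := (hV.1 q.1).1.2 q.2.1 hx0
      exact htt ((huniq t hq.1).trans (huniq t' (exy ▸ hq.2)).symm)
    have himg : (D.transpose.crossPairs t t').image (fun q => q.2.1 - q.2.2) = univ.filter fun y : Fin p => y ≠ 0 := by
      apply Finset.eq_of_subset_of_card_le
      · intro d hd
        simp only [mem_image] at hd
        obtain ⟨q, hq, rfl⟩ := hd
        simp only [mem_filter, mem_univ, true_and]
        exact hne0 q hq
      · rw [card_image_of_injOn hinj, card_nonzero, card_crossPairs_eq_sum]
        have h1 := (D.om_col_equations hV hp).2 t t' htt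
        simp only [om_transpose]
        omega
    have hmem : δ ∈ (D.transpose.crossPairs t t').image (fun q => q.2.1 - q.2.2) := by
      rw [himg]; simp [hδ]
    simp only [mem_image] at hmem
    obtain ⟨q, hq, hqδ⟩ := hmem
    simp only [crossPairs, mem_filter, mem_univ, true_and, transpose_mem] at hq
    refine ⟨q.1, q.2.1, hq.1, by rw [← hqδ, sub_sub_cancel]; exact hq.2, fun s' x' h1' h2' => ?_⟩
    simp only [transpose_mem] at h1' h2'
    exact D.col_cross_unique hV htt hq.1 (by rw [← hqδ, sub_sub_cancel]; exact hq.2) h1' h2'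

/-- **duality: the transpose of valid lift data is valid** (`2 ≤ p`) -/
theorem valid_transpose (D : LiftData N p) (hV : D.Valid) (hp : 2 ≤ p) : D.transpose.Valid :=
  ⟨fun t => ⟨D.rowPartition_transpose hV t, D.internal_transpose hV hp t⟩, fun _ _ htt => D.cross_transpose hV hp htt⟩

/-- validity is invariant under transposition (`2 ≤ p`) -/
theorem valid_transpose_iff (D : LiftData N p) (hp : 2 ≤ p) : D.transpose.Valid ↔ D.Valid :=
  ⟨fun h => by simpa only [transpose_transpose] using D.transpose.valid_transpose h hp, fun h => D.valid_transpose h hp⟩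

end LiftData

/-- **Symmetry reduction by duality:** to refute all valid `LiftData 11 13` in a normal form `NF` closed under nothing in particular, it suffices to refute, for each
`D`, either `D` or its transpose — formally: if every valid `D` has `NF D ∨ NF D.transpose`, refuting the normal form refutes everything. -/
theorem noLiftData13_of_transpose_normalized (NF : LiftData 11 13 → Prop)
    (hcover : ∀ D : LiftData 11 13, D.Valid → NF D ∨ NF D.transpose) (hNF : ∀ D : LiftData 11 13, NF D → ¬ D.Valid) : NoLiftData13 := by
  intro D hD
  rcases hcover D hD with h | h
  · exact hNF D h hD
  · exact hNF _ h (D.valid_transpose hD (by norm_num))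

end Summit.Ventures.DiscreteObjects.PP12
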